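/-
Copyright (c) 2026 the pub-hodgecm-mathlib formalisation cell (harness21).  Prover seat hodgecm-mathlib-K2E5-p16 (g7), Track B «K2-LIT»,
#184♮ = hLiu418 = `stmt-HodgeConjecture-24832`; #42S organ S2, S2-asm road (γ), FILE 6 `K2LiuArchOnePlaceSystemPackage` (S2 desk K2Liu-p05 (g6) 15:42:01Z
«(a) YES — `exists_onePlaceSystem` = F0P2-p08's (H1) BYTES»; LEAD F0P6-plan (g14) BATCH #48).  THEOREMS ONLY (no `def`, no `instance`, no notation, no named-fact
hypothesis, no `sorry`); the Mathlib idiom `attribute [local instance 100] LieRing.ofAssociativeRing` (to NAME `↥(uFormGroup (Fin 2) (Fin 2)).lie.toSubmodule`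
in ★ D1's `hιψ` bytes; exactly as ★ p861276 ∕ ★ p861294 ∕ ★ p861459).
-/
import Summits.HodgeConjecture.HodgeConjecture.Theorems.K2LiuArchReadingChartPlaceSecArch   -- ★ FILE 5b p861459: (F2′) `exists_lie_exp_readingChart_eq_placeSec_relabel`
import Summits.HodgeConjecture.HodgeConjecture.Theorems.K2LiuArchJunctionFrameData          -- ★ K2Liu-p25 p861386: `exists_junctionFrameData`, `hsec_placeSec_relabel`
import Summits.HodgeConjecture.HodgeConjecture.Theorems.K2LiuArchDoubledSignFrameTwo        -- ★ K2Liu-p25 p861407: `exists_signFrame`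
import HarnessLib

/-!
# Crux `HLiu418`, organ S2, FILE 6: the one-place system PACKAGE `(R, S, eP, eQ, ψ ; hsec ∧ hιψ)` — the final assembly's hypothesis (H1)

Cell `hodgecm-mathlib`, crux item hLiu418 = `stmt-HodgeConjecture-24832` (helper lane `--supports`, count-neutral).  For the #42S small frame
(`e : Fin N × Fin M ≃ Fin 2`, doubled group `U(2,2)`), a real place `σ` of `L⁺` with the complex place `w = cmPlaceOver L σ` above it, and ANY reading chart `ιw` at `w`
with ★ FILE 4's matrix formula (`hιM`), **`exists_onePlaceSystem`** delivers F0P2-p08 (g0)'s hypothesis (H1) of the final assembly `K2LiuArchSWSpanningStd` VERBATIM: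
junction block types `R := PosIdx y_σ`, `S := NegIdx y_σ`, junction equivalences `(eP, eQ)` of the BIG sign frame at `σ`, the one-place homomorphism
`ψ := placeSec_𝔻 σ ∘ UForm.relabel eSp eSq : U(2,2) →* H(L⁺ ⊗ ℝ)`, ★ D2 p861276's `hsec` bytes (`(ψ h) ⊗ 1 = placeSecJ_𝕎 σ eP eQ (toBig (h, 1), 1)`) AND ★ D1 p861294's
`hιψ` bytes (the exponential curves of the chart are `ψ (exp (sY′))`).  Assembly only: ★ K2Liu-p25 `exists_signFrame` (the blocks `eSp, eSq`) + ★ K2Liu-p25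
`exists_junctionFrameData` ∕ `hsec_placeSec_relabel` + ★ FILE 5b (F2′).  Stated with `(σ) (w) (hw : cmPlaceOver L σ = w)` so that the consumer instantiates
`σ := under w`, `hw := hunder w` without transporting along the place.
References: [KonnoKonno2007, §3.1]; [Kudla1994, §2]; [BorelJacquet1979, §4.1]; [Knapp1986, Ch. VI §2]; [Shimura1997, §6].
HONEST LABEL: HC_CM is proved only modulo the 7 printed citations (2 remaining named inputs: hLiu418 = stmt-HodgeConjecture-24832,
h413 = stmt-HodgeConjecture-24833) until rung 0 closes; count-neutral helper, closes no socket.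
-/

set_option autoImplicit false
set_option linter.dupNamespace false

noncomputable section

-- Mathlib idiom (`Mathlib/Algebra/Lie/OfAssociative.lean`, as ★ `JunctionLinearRealGroup` ∕ ★ p861276 ∕ ★ p861294 ∕ ★ p861459): the commutator bracket on
-- `Matrix _ _ ℂ`, needed to name `↥(uFormGroup (Fin 2) (Fin 2)).lie.toSubmodule` in ★ D1's `hιψ` bytes; overrides nothing.
attribute [local instance 100] LieRing.ofAssociativeRing

namespace Summit.HodgeConjecture.HodgeConjecture.Cruxes.HLiu418.K2LiuArchOnePlaceSystemPackage

open Matrix Complex NumberField NumberField.InfinitePlace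
open scoped MatrixGroups ComplexConjugate Classical
open Literature.NumberTheory.Automorphic Literature.NumberTheory.Automorphic.UnitaryGroup Literature.NumberTheory.Weil1964
open Literature.NumberTheory.GelbartRogawski1991 Literature.NumberTheory.GelbartRogawski1991.UnitaryDualPair
open Literature.NumberTheory.GelbartRogawski1991.GRConstruction Literature.NumberTheory.K2Lit.SiegelDoubled
open Literature.RepresentationTheory.KonnoKonno2007 Literature.RepresentationTheory.KonnoKonno2007.RealDualPair
open Summit.HodgeConjecture.HodgeConjecture.Cruxes.HLiu418 (K2LiuArchOneParameterOrbitDefs.archEmb)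
open K2LiuArchSectionPlaceBlock K2LiuArchTensorPlaceSec

variable (L : Type) [Field L] [NumberField L] [IsCMField L] {N M : ℕ} (e : Fin N × Fin M ≃ Fin 2)
  (dV : Fin N → L) (hdV : ∀ i, IsCMField.complexConj L (dV i) = dV i) (hdV0 : ∀ i, dV i ≠ 0)
  (dW : Fin M → L) (hdW : ∀ i, IsCMField.complexConj L (dW i) = dW i) (hdW0 : ∀ j, dW j ≠ 0)
variable {M₂ M' n' : ℕ} (eW : Fin M × Fin M₂ ≃ Fin M') (e' : Fin N × Fin M' ≃ Fin n')
  (dV' : Fin M₂ → L) (hdV' : ∀ k, IsCMField.complexConj L (dV' k) = dV' k) (hdV'0 : ∀ k, dV' k ≠ 0)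

/-- **THE ONE-PLACE SYSTEM PACKAGE = (H1) OF THE FINAL ASSEMBLY.**  For the small frame `e : Fin N × Fin M ≃ Fin 2`, a real place `σ` below the complex place `w`
(`hw : cmPlaceOver L σ = w`) and a reading chart `ιw` at `w` with ★ FILE 4's matrix formula `hιM`: there are junction blocks `R S`, junction equivalences
`eP : 𝕎⁺_σ ≃ (Fin 2 × R) ⊕ (Fin 2 × S)`, `eQ : 𝕎⁻_σ ≃ (Fin 2 × S) ⊕ (Fin 2 × R)` and `ψ : U(2,2) →* H(L⁺ ⊗ ℝ)` with ★ D2's `hsec` AND ★ D1's `hιψ` — namely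
`R, S := PosIdx∕NegIdx y_σ` and `(eP, eQ)` from ★ `exists_junctionFrameData`, `ψ := placeSec_𝔻 σ ∘ relabel eSp eSq` (★ `exists_signFrame`), `hsec` = ★ `hsec_placeSec_relabel`,
`hιψ` = ★ FILE 5b (F2′). [cite: KonnoKonno2007, §3.1 (3.1)] [cite: Kudla1994, §2] [cite: Knapp1986, Ch. VI §2] [cite: BorelJacquet1979, §4.1] -/
theorem exists_onePlaceSystem (σ : {v : InfinitePlace (Fp L) // v.IsReal}) (w : {w : InfinitePlace L // w.IsComplex}) (hw : cmPlaceOver L σ = w)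
    (ιw : Matrix (Fin 2 ⊕ Fin 2) (Fin 2 ⊕ Fin 2) ℂ → archLocal L (2 + 2) (hermD L e dV hdV dW hdW) w)
    (hιM : ∀ P : Matrix (Fin 2 ⊕ Fin 2) (Fin 2 ⊕ Fin 2) ℂ, Pᴴ * Matrix.J (Fin 2) ℂ * P = Matrix.J (Fin 2) ℂ →
      ((((ιw P : archLocal L (2 + 2) (hermD L e dV hdV dW hdW) w) : GL (Fin (2 + 2)) ℂ)) : Matrix (Fin (2 + 2)) (Fin (2 + 2)) ℂ) =
        Matrix.reindex (e₂ (n := 2)) (e₂ (n := 2))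
          (fromBlocks (diagonal (fun k => (((Real.sqrt (|(w.1.embedding (dV (e.symm k).1 * dW (e.symm k).2)).re| / 2))⁻¹ / 2 : ℝ) : ℂ)))
              (-diagonal (fun k => I * (((Real.sqrt (|(w.1.embedding (dV (e.symm k).1 * dW (e.symm k).2)).re| / 2))⁻¹ *
                ((w.1.embedding (dV (e.symm k).1 * dW (e.symm k).2)).re / |(w.1.embedding (dV (e.symm k).1 * dW (e.symm k).2)).re|) / 2 : ℝ) : ℂ)))
              (diagonal (fun k => (((Real.sqrt (|(w.1.embedding (dV (e.symm k).1 * dW (e.symm k).2)).re| / 2))⁻¹ / 2 : ℝ) : ℂ)))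
              (diagonal (fun k => I * (((Real.sqrt (|(w.1.embedding (dV (e.symm k).1 * dW (e.symm k).2)).re| / 2))⁻¹ *
                ((w.1.embedding (dV (e.symm k).1 * dW (e.symm k).2)).re / |(w.1.embedding (dV (e.symm k).1 * dW (e.symm k).2)).re|) / 2 : ℝ) : ℂ))) * P *
            fromBlocks (diagonal (fun k => (Real.sqrt (|(w.1.embedding (dV (e.symm k).1 * dW (e.symm k).2)).re| / 2) : ℂ)))
              (diagonal (fun k => (Real.sqrt (|(w.1.embedding (dV (e.symm k).1 * dW (e.symm k).2)).re| / 2) : ℂ)))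
              (diagonal (fun k => I * ((((w.1.embedding (dV (e.symm k).1 * dW (e.symm k).2)).re / |(w.1.embedding (dV (e.symm k).1 * dW (e.symm k).2)).re|) *
                Real.sqrt (|(w.1.embedding (dV (e.symm k).1 * dW (e.symm k).2)).re| / 2) : ℝ) : ℂ)))
              (-diagonal (fun k => I * ((((w.1.embedding (dV (e.symm k).1 * dW (e.symm k).2)).re / |(w.1.embedding (dV (e.symm k).1 * dW (e.symm k).2)).re|) *
                Real.sqrt (|(w.1.embedding (dV (e.symm k).1 * dW (e.symm k).2)).re| / 2) : ℝ) : ℂ))))) :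
    ∃ (R S : Type) (_ : Fintype R) (_ : DecidableEq R) (_ : Fintype S) (_ : DecidableEq S)
      (eP : PosIdx (signVec (cmPlaceOver L) (fun k => Sum.elim (cmGramEntry L e' dV hdV (tensorFrame L dW eW dV') (tensorFrame_real L dW hdW eW dV' hdV')) (-cmGramEntry L e' dV hdV (tensorFrame L dW eW dV') (tensorFrame_real L dW hdW eW dV' hdV')) ((UnitaryDualPair.LocalSplitting.e₂ n').symm k)) (imagUnit L) σ) ≃ (Fin 2 × R) ⊕ (Fin 2 × S))
      (eQ : NegIdx (signVec (cmPlaceOver L) (fun k => Sum.elim (cmGramEntry L e' dV hdV (tensorFrame L dW eW dV') (tensorFrame_real L dW hdW eW dV' hdV')) (-cmGramEntry L e' dV hdV (tensorFrame L dW eW dV') (tensorFrame_real L dW hdW eW dV' hdV')) ((UnitaryDualPair.LocalSplitting.e₂ n').symm k)) (imagUnit L) σ) ≃ (Fin 2 × S) ⊕ (Fin 2 × R))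
      (ψ : UForm (Fin 2) (Fin 2) →* UnitaryGroup.arch (Fp L) L (IsCMField.complexConj L) (2 + 2) (hermD L e dV hdV dW hdW)),
      (∀ h : UForm (Fin 2) (Fin 2),
        tensorEmb L e dV hdV dW hdW eW e' dV' hdV' (K2LiuArchOneParameterOrbitDefs.archEmb (Fp L) L (IsCMField.complexConj L) (2 + 2) (hermD L e dV hdV dW hdW) (ψ h)) =
          K2LiuArchOneParameterOrbitDefs.archEmb (Fp L) L (IsCMField.complexConj L) (n' + n') (hermD L e' dV hdV (tensorFrame L dW eW dV') (tensorFrame_real L dW hdW eW dV' hdV'))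
            (placeSecJ L (IsCMField.complexConj L) (n' + n') (IsCMField.complexConj_ne_one L) (cmPlaceOver L) (cmPlaceOver_smul L) _
                  (gramD_gram_realDiagonal_entry_ne_zero L e' dV hdV (tensorFrame L dW eW dV') (tensorFrame_real L dW hdW eW dV' hdV') hdV0 (tensorFrame_ne_zero L dW eW dV' hdW0 hdV'0)) (complexConj_imagUnit L) (imagUnit_ne_zero L) σ
                  (cmPlaceOver_comap L) (gramD_eq_diagonal_cm L e' dV hdV (tensorFrame L dW eW dV') (tensorFrame_real L dW hdW eW dV' hdV')) (J := hermD L e' dV hdV (tensorFrame L dW eW dV') (tensorFrame_real L dW hdW eW dV' hdV')) rfl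
                  (complexConj_smul_infinitePlace L) eP eQ ((toBig (Fin 2) (Fin 2) R S (h, 1), (1 : UForm Unit Empty)) : Ginf ((Fin 2 × R) ⊕ (Fin 2 × S)) ((Fin 2 × S) ⊕ (Fin 2 × R)) Unit Empty))) ∧
      (∀ α β γ δ : Matrix (Fin 2) (Fin 2) ℂ, (fromBlocks 1 1 (I • 1) (-(I • 1)) * fromBlocks α β γ δ * ((2 : ℂ)⁻¹ • fromBlocks 1 (-(I • 1)) 1 (I • 1)) : Matrix (Fin 2 ⊕ Fin 2) (Fin 2 ⊕ Fin 2) ℂ)ᴴ * Matrix.J (Fin 2) ℂ + Matrix.J (Fin 2) ℂ * (fromBlocks 1 1 (I • 1) (-(I • 1)) * fromBlocks α β γ δ * ((2 : ℂ)⁻¹ • fromBlocks 1 (-(I • 1)) 1 (I • 1)) : Matrix (Fin 2 ⊕ Fin 2) (Fin 2 ⊕ Fin 2) ℂ) = 0 →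
        ∃ Y' : ↥(uFormGroup (Fin 2) (Fin 2)).lie.toSubmodule, ∀ s : ℝ,
          (UnitaryGroup.archPiEquivCM (2 + 2) L (hermD L e dV hdV dW hdW)).symm (Pi.mulSingle w (ιw (NormedSpace.exp (s • (fromBlocks 1 1 (I • 1) (-(I • 1)) * fromBlocks α β γ δ * ((2 : ℂ)⁻¹ • fromBlocks 1 (-(I • 1)) 1 (I • 1)) : Matrix (Fin 2 ⊕ Fin 2) (Fin 2 ⊕ Fin 2) ℂ))))) = ψ ((uFormGroup (Fin 2) (Fin 2)).expMem ⟨((s • Y' : ↥(uFormGroup (Fin 2) (Fin 2)).lie.toSubmodule) : Matrix (Fin 2 ⊕ Fin 2) (Fin 2 ⊕ Fin 2) ℂ), (s • Y').2⟩ : UForm (Fin 2) (Fin 2))) := by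
  subst hw
  -- the blocks of the small sign frame (★ K2Liu-p25 `exists_signFrame`) and the junction frame data (★ K2Liu-p25 `exists_junctionFrameData`)
  obtain ⟨eSp, eSq, -⟩ := K2LiuArchDoubledSignFrameTwo.exists_signFrame L e dV hdV hdV0 dW hdW hdW0 σ
  obtain ⟨y, hy, hz, eP, eQ, hE⟩ := K2LiuArchJunctionFrameData.exists_junctionFrameData L e dV hdV hdV0 dW hdW hdW0 eW e' dV' hdV' hdV'0
  exact ⟨PosIdx (y σ), NegIdx (y σ), inferInstance, inferInstance, inferInstance, inferInstance,
    (eP σ).symm.trans (Equiv.sumCongr (eSp.symm.prodCongr (Equiv.refl (PosIdx (y σ)))) (eSq.symm.prodCongr (Equiv.refl (NegIdx (y σ))))),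
    (eQ σ).symm.trans (Equiv.sumCongr (eSp.symm.prodCongr (Equiv.refl (NegIdx (y σ)))) (eSq.symm.prodCongr (Equiv.refl (PosIdx (y σ))))),
    (placeSec L (IsCMField.complexConj L) (2 + 2) (IsCMField.complexConj_ne_one L) (cmPlaceOver L) (cmPlaceOver_smul L) _
            (gramD_gram_realDiagonal_entry_ne_zero L e dV hdV dW hdW hdV0 hdW0) (complexConj_imagUnit L) (imagUnit_ne_zero L) σ
            (cmPlaceOver_comap L) (gramD_eq_diagonal_cm L e dV hdV dW hdW) (J := hermD L e dV hdV dW hdW) rfl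
            (complexConj_smul_infinitePlace L)).comp
      (UForm.relabel (Fin 2) (Fin 2) (PosIdx (signVec (cmPlaceOver L) (fun k => Sum.elim (cmGramEntry L e dV hdV dW hdW) (-cmGramEntry L e dV hdV dW hdW) ((UnitaryDualPair.LocalSplitting.e₂ 2).symm k)) (imagUnit L) σ)) (NegIdx (signVec (cmPlaceOver L) (fun k => Sum.elim (cmGramEntry L e dV hdV dW hdW) (-cmGramEntry L e dV hdV dW hdW) ((UnitaryDualPair.LocalSplitting.e₂ 2).symm k)) (imagUnit L) σ)) eSp eSq).toMonoidHom,
    K2LiuArchJunctionFrameData.hsec_placeSec_relabel L e dV hdV hdV0 dW hdW hdW0 eW e' dV' hdV' hdV'0 σ (y σ) (hy σ) (hz σ) (eP σ) (eQ σ) (hE σ) eSp eSq,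
    fun α β γ δ hX => K2LiuArchReadingChartPlaceSecArch.exists_lie_exp_readingChart_eq_placeSec_relabel L e dV hdV dW hdW hdV0 hdW0 σ ιw hιM eSp eSq
      (fromBlocks α β γ δ) hX⟩

/-- **THE SAME PACKAGE, INDEXED BY THE COMPLEX PLACE ALONE** (F0P2-p08 (g0)'s `hF2′` binder shape `∀ w ιw, hιM → … → ∃ σ R S …`): every complex place `w` of the
CM field `L` lies over the real place `σ := w|_{L⁺}` of `L⁺` (`cmPlaceOver L σ = w`, ★ `cmPlaceOver_eq_mk`), so `exists_onePlaceSystem` yields `∃ σ, (H1 at σ, w)`.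
[cite: KonnoKonno2007, §3.1 (3.1)] [cite: BorelJacquet1979, §4.1] -/
theorem exists_onePlaceSystem_of_place (w : {w : InfinitePlace L // w.IsComplex})
    (ιw : Matrix (Fin 2 ⊕ Fin 2) (Fin 2 ⊕ Fin 2) ℂ → archLocal L (2 + 2) (hermD L e dV hdV dW hdW) w)
    (hιM : ∀ P : Matrix (Fin 2 ⊕ Fin 2) (Fin 2 ⊕ Fin 2) ℂ, Pᴴ * Matrix.J (Fin 2) ℂ * P = Matrix.J (Fin 2) ℂ →
      ((((ιw P : archLocal L (2 + 2) (hermD L e dV hdV dW hdW) w) : GL (Fin (2 + 2)) ℂ)) : Matrix (Fin (2 + 2)) (Fin (2 + 2)) ℂ) =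
        Matrix.reindex (e₂ (n := 2)) (e₂ (n := 2))
          (fromBlocks (diagonal (fun k => (((Real.sqrt (|(w.1.embedding (dV (e.symm k).1 * dW (e.symm k).2)).re| / 2))⁻¹ / 2 : ℝ) : ℂ)))
              (-diagonal (fun k => I * (((Real.sqrt (|(w.1.embedding (dV (e.symm k).1 * dW (e.symm k).2)).re| / 2))⁻¹ *
                ((w.1.embedding (dV (e.symm k).1 * dW (e.symm k).2)).re / |(w.1.embedding (dV (e.symm k).1 * dW (e.symm k).2)).re|) / 2 : ℝ) : ℂ)))
              (diagonal (fun k => (((Real.sqrt (|(w.1.embedding (dV (e.symm k).1 * dW (e.symm k).2)).re| / 2))⁻¹ / 2 : ℝ) : ℂ)))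
              (diagonal (fun k => I * (((Real.sqrt (|(w.1.embedding (dV (e.symm k).1 * dW (e.symm k).2)).re| / 2))⁻¹ *
                ((w.1.embedding (dV (e.symm k).1 * dW (e.symm k).2)).re / |(w.1.embedding (dV (e.symm k).1 * dW (e.symm k).2)).re|) / 2 : ℝ) : ℂ))) * P *
            fromBlocks (diagonal (fun k => (Real.sqrt (|(w.1.embedding (dV (e.symm k).1 * dW (e.symm k).2)).re| / 2) : ℂ)))
              (diagonal (fun k => (Real.sqrt (|(w.1.embedding (dV (e.symm k).1 * dW (e.symm k).2)).re| / 2) : ℂ)))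
              (diagonal (fun k => I * ((((w.1.embedding (dV (e.symm k).1 * dW (e.symm k).2)).re / |(w.1.embedding (dV (e.symm k).1 * dW (e.symm k).2)).re|) *
                Real.sqrt (|(w.1.embedding (dV (e.symm k).1 * dW (e.symm k).2)).re| / 2) : ℝ) : ℂ)))
              (-diagonal (fun k => I * ((((w.1.embedding (dV (e.symm k).1 * dW (e.symm k).2)).re / |(w.1.embedding (dV (e.symm k).1 * dW (e.symm k).2)).re|) *
                Real.sqrt (|(w.1.embedding (dV (e.symm k).1 * dW (e.symm k).2)).re| / 2) : ℝ) : ℂ))))) :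
    ∃ (σ : {v : InfinitePlace (Fp L) // v.IsReal}) (R S : Type) (_ : Fintype R) (_ : DecidableEq R) (_ : Fintype S) (_ : DecidableEq S)
      (eP : PosIdx (signVec (cmPlaceOver L) (fun k => Sum.elim (cmGramEntry L e' dV hdV (tensorFrame L dW eW dV') (tensorFrame_real L dW hdW eW dV' hdV')) (-cmGramEntry L e' dV hdV (tensorFrame L dW eW dV') (tensorFrame_real L dW hdW eW dV' hdV')) ((UnitaryDualPair.LocalSplitting.e₂ n').symm k)) (imagUnit L) σ) ≃ (Fin 2 × R) ⊕ (Fin 2 × S))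
      (eQ : NegIdx (signVec (cmPlaceOver L) (fun k => Sum.elim (cmGramEntry L e' dV hdV (tensorFrame L dW eW dV') (tensorFrame_real L dW hdW eW dV' hdV')) (-cmGramEntry L e' dV hdV (tensorFrame L dW eW dV') (tensorFrame_real L dW hdW eW dV' hdV')) ((UnitaryDualPair.LocalSplitting.e₂ n').symm k)) (imagUnit L) σ) ≃ (Fin 2 × S) ⊕ (Fin 2 × R))
      (ψ : UForm (Fin 2) (Fin 2) →* UnitaryGroup.arch (Fp L) L (IsCMField.complexConj L) (2 + 2) (hermD L e dV hdV dW hdW)),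
      (∀ h : UForm (Fin 2) (Fin 2),
        tensorEmb L e dV hdV dW hdW eW e' dV' hdV' (K2LiuArchOneParameterOrbitDefs.archEmb (Fp L) L (IsCMField.complexConj L) (2 + 2) (hermD L e dV hdV dW hdW) (ψ h)) =
          K2LiuArchOneParameterOrbitDefs.archEmb (Fp L) L (IsCMField.complexConj L) (n' + n') (hermD L e' dV hdV (tensorFrame L dW eW dV') (tensorFrame_real L dW hdW eW dV' hdV'))
            (placeSecJ L (IsCMField.complexConj L) (n' + n') (IsCMField.complexConj_ne_one L) (cmPlaceOver L) (cmPlaceOver_smul L) _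
                  (gramD_gram_realDiagonal_entry_ne_zero L e' dV hdV (tensorFrame L dW eW dV') (tensorFrame_real L dW hdW eW dV' hdV') hdV0 (tensorFrame_ne_zero L dW eW dV' hdW0 hdV'0)) (complexConj_imagUnit L) (imagUnit_ne_zero L) σ
                  (cmPlaceOver_comap L) (gramD_eq_diagonal_cm L e' dV hdV (tensorFrame L dW eW dV') (tensorFrame_real L dW hdW eW dV' hdV')) (J := hermD L e' dV hdV (tensorFrame L dW eW dV') (tensorFrame_real L dW hdW eW dV' hdV')) rfl
                  (complexConj_smul_infinitePlace L) eP eQ ((toBig (Fin 2) (Fin 2) R S (h, 1), (1 : UForm Unit Empty)) : Ginf ((Fin 2 × R) ⊕ (Fin 2 × S)) ((Fin 2 × S) ⊕ (Fin 2 × R)) Unit Empty))) ∧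
      (∀ α β γ δ : Matrix (Fin 2) (Fin 2) ℂ, (fromBlocks 1 1 (I • 1) (-(I • 1)) * fromBlocks α β γ δ * ((2 : ℂ)⁻¹ • fromBlocks 1 (-(I • 1)) 1 (I • 1)) : Matrix (Fin 2 ⊕ Fin 2) (Fin 2 ⊕ Fin 2) ℂ)ᴴ * Matrix.J (Fin 2) ℂ + Matrix.J (Fin 2) ℂ * (fromBlocks 1 1 (I • 1) (-(I • 1)) * fromBlocks α β γ δ * ((2 : ℂ)⁻¹ • fromBlocks 1 (-(I • 1)) 1 (I • 1)) : Matrix (Fin 2 ⊕ Fin 2) (Fin 2 ⊕ Fin 2) ℂ) = 0 →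
        ∃ Y' : ↥(uFormGroup (Fin 2) (Fin 2)).lie.toSubmodule, ∀ s : ℝ,
          (UnitaryGroup.archPiEquivCM (2 + 2) L (hermD L e dV hdV dW hdW)).symm (Pi.mulSingle w (ιw (NormedSpace.exp (s • (fromBlocks 1 1 (I • 1) (-(I • 1)) * fromBlocks α β γ δ * ((2 : ℂ)⁻¹ • fromBlocks 1 (-(I • 1)) 1 (I • 1)) : Matrix (Fin 2 ⊕ Fin 2) (Fin 2 ⊕ Fin 2) ℂ))))) = ψ ((uFormGroup (Fin 2) (Fin 2)).expMem ⟨((s • Y' : ↥(uFormGroup (Fin 2) (Fin 2)).lie.toSubmodule) : Matrix (Fin 2 ⊕ Fin 2) (Fin 2 ⊕ Fin 2) ℂ), (s • Y').2⟩ : UForm (Fin 2) (Fin 2))) := by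
  -- the real place under `w`
  obtain ⟨σ, hσ⟩ : ∃ σ : {v : InfinitePlace (Fp L) // v.IsReal}, cmPlaceOver L σ = w :=
    ⟨⟨w.1.comap (algebraMap (Fp L) L), IsTotallyReal.isReal _⟩,
      Subtype.ext ((cmPlaceOver_eq_mk L _ w.1.embedding (by rw [mk_embedding])).trans (mk_embedding w.1))⟩
  exact ⟨σ, exists_onePlaceSystem L e dV hdV hdV0 dW hdW hdW0 eW e' dV' hdV' hdV'0 σ w hσ ιw hιM⟩

end Summit.HodgeConjecture.HodgeConjecture.Cruxes.HLiu418.K2LiuArchOnePlaceSystemPackage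

end
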